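import Mathlib
import HarnessLib
import Literature.Computability.AlgebraicComplexity.PatternExpressions
import Literature.Computability.AlgebraicComplexity.DiPatternExpressions
import Summits.ValiantsHypothesis.ValiantsHypothesis.Theorems.MonotoneRestorationOrbitRestorationLinearVolumeQPDiUnfolding
import Summits.ValiantsHypothesis.ValiantsHypothesis.Theorems.MonotoneRestorationOrbitRestorationLinearVolumeQPBlockDescent
import Summits.ValiantsHypothesis.ValiantsHypothesis.Theorems.MonotoneRestorationOrbitCompressionQPDiCompressionFloors

/-!
# Route MonotoneRestoration — aside `OrbitRestorationLinearVolumeQP` (stmt-ValiantsHypothesis-18294) /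
# crux `OrbitRestorationQP` (stmt-18293): BIPARTITE UNFOLDING K1ᵉ ⟹ K1 — the closed polynomial of a labelled
# BIPARTITE expression with `k` row and `l` column labels lies in the span of the homomorphism polynomials of
# BIPARTITE patterns of treewidth `≤ k + l - 1`, at every level and in every degree

Census item (3)/(b) of the line-`birth` hands (6-g0 / 5-g2 / 8-g0 exit reports: "bipartite unfolding
`PatternExpr k l ⟹ span{hom_F : tw F ≤ k + l - 1}` (K1ᵉ ⟹ K1), M, needs a 2-colouring-refined copy of the
DiUnfolding induction") — DONE HERE.  The one-sorted unfolding (`DiUnfolding.value_mem_span`, p829010) expands the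
labelled value of a `k`-label one-sorted expression into labelled values of CERTIFIED labelled patterns
(elimination-ordering certificate of width `k - 1`).  Reading a bipartite expression as a one-sorted one with
`k + l` labels (row label `a ↦ Fin.castAdd l a`, column label `b ↦ Fin.natAdd k b`, as in
`CompressionFloors.exists_diExpr_of_patternExpr`), the same induction carries one more invariant: a CONSISTENT
2-COLOURING of the certified pattern (every edge from a `false` vertex to a `true` vertex) extending the label
colouring (row labels `false`, column labels `true`):

* `colour_glue_left/right`, `colour_forget` — the colouring survives gluing (`certificate_glue`) and forgetting a
  label (`certificate_forget`: the new inner vertex keeps the colour of the old holder of the label);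
* `value_mem_span_coloured` — the COLOURED UNFOLDING (labelled form);
* `close_mem_span_homPoly` — **K1ᵉ ⟹ K1: `e.close n ∈ span{hom_{F,n} : F bipartite, tw F ≤ k + l - 1}` for
  every `e : PatternExpr ℂ k l` and every `n`** (close the unfolding, `labelledValue_close`; bound the treewidth by
  the certificate, `treewidth_le_of_certificate`; DEORIENT the consistently coloured pattern into a bipartite one of
  no larger treewidth, `BlockDescent.exists_homPoly_eq_diHomPoly_of_colouring` — the deorientation lemma of the
  block-descent file is exactly the missing last step); `close_mem_narrowSpan` — width form.

With K2 (`OrbitRestorationQPHomPolyClose.stub_homPoly_close`: tw `≤ w` ⟹ closed expression with `w + 1` labels a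
side) this makes "narrow bipartite EXPRESSIONS" and "narrow bipartite SPAN" the same currency up to the factor 2 in
the label count (`k + l` labels ↔ width `k + l - 1`), e.g. the hypotheses of
`OrbitRestorationLinearVolumeQPNarrow.orbitRestorationLinearVolumeQP_of_lvNarrowExpressions` and
`…_of_lvNarrowSpan`.  Honest label: bookkeeping for the parent crux; the stub `stub_lvNarrowSpan`, R1 and VP ≠ VNP
are NOT moved.  Def-free, route-independent helper (`--supports stmt-ValiantsHypothesis-18294`); nothing here is a
named fact.

References: Dawar–Pago–Seppelt 2025 (arXiv:2502.06740) §5 (labelled pattern expressions = tree decompositions),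
§7 p. 45; Dwivedi–Pago–Seppelt 2026 (arXiv:2601.09343) eq. (1).
-/

noncomputable section

open scoped Classical

-- `Summit.ValiantsHypothesis.ValiantsHypothesis.…` is the tree's single-conjunct layout (Sub = Summit).
set_option linter.dupNamespace false

namespace Summit.ValiantsHypothesis.ValiantsHypothesis.Theorems.BipartiteUnfoldingColoured

open Literature.Computability.AlgebraicComplexity MvPolynomial
open Literature.Combinatorics.SimpleGraph (treewidth)
open Summit.ValiantsHypothesis.ValiantsHypothesis.Theorems
open Summit.ValiantsHypothesis.ValiantsHypothesis.Theorems.DiUnfolding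

variable {k l : ℕ} (n : ℕ)

/-! ### Colour bookkeeping for gluing and forgetting -/

/-- Gluing: the colouring of the glued pattern restricts to the first colouring along the first embedding.
[folklore] -/
theorem colour_glue_left {m₁ m₂ : ℕ} (lab : Fin (k + l) → Bool) (col₁ : Fin (k + l) ⊕ Fin m₁ → Bool)
    (col₂ : Fin (k + l) ⊕ Fin m₂ → Bool) (hlab : ∀ c, col₁ (Sum.inl c) = lab c)
    (x : Fin (k + l) ⊕ Fin m₁) :
    Sum.elim lab (Fin.append (fun j => col₁ (Sum.inr j)) (fun j => col₂ (Sum.inr j)))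
        (Sum.map id (Fin.castAdd m₂) x) = col₁ x := by
  rcases x with c | j
  · simp [hlab]
  · simp [Fin.append_left]

/-- Gluing: the colouring of the glued pattern restricts to the second colouring along the second embedding.
[folklore] -/
theorem colour_glue_right {m₁ m₂ : ℕ} (lab : Fin (k + l) → Bool) (col₁ : Fin (k + l) ⊕ Fin m₁ → Bool)
    (col₂ : Fin (k + l) ⊕ Fin m₂ → Bool) (hlab : ∀ c, col₂ (Sum.inl c) = lab c)
    (x : Fin (k + l) ⊕ Fin m₂) :
    Sum.elim lab (Fin.append (fun j => col₁ (Sum.inr j)) (fun j => col₂ (Sum.inr j)))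
        (Sum.map id (Fin.natAdd m₁) x) = col₂ x := by
  rcases x with c | j
  · simp [hlab]
  · simp [Fin.append_right]

/-- Forgetting label `a`: the colouring of the new pattern (the new inner vertex keeps the colour of the old
holder of `a`, the fresh holder of `a` has the label colour) restricts to the old colouring along `ψ`. [folklore] -/
theorem colour_forget {m : ℕ} (a : Fin (k + l)) (lab : Fin (k + l) → Bool)
    (col : Fin (k + l) ⊕ Fin m → Bool) (hlab : ∀ c, col (Sum.inl c) = lab c) (x : Fin (k + l) ⊕ Fin m) :
    Sum.elim lab (Fin.append (fun j => col (Sum.inr j)) (fun _ : Fin 1 => col (Sum.inl a)))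
        (Sum.elim (fun b => if b = a then Sum.inr (Fin.natAdd m 0) else Sum.inl b)
          (fun j => Sum.inr (Fin.castAdd 1 j)) x) = col x := by
  rcases x with b | j
  · by_cases hb : b = a
    · subst hb
      simp [Fin.append_right]
    · simp [hb, hlab]
  · simp [Fin.append_left]

/-! ### The coloured unfolding of a bipartite expression (labelled form) -/

/-- **COLOURED UNFOLDING OF A BIPARTITE `k,l`-LABEL EXPRESSION (labelled form).**  Read a bipartite expression
as a one-sorted one with `k + l` labels (row label `a` ↦ `Fin.castAdd l a`, column label `b` ↦ `Fin.natAdd k b`).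
Its labelled value `ℓ ↦ value n e (ℓ ∘ castAdd) (ℓ ∘ natAdd)` is a `ℂ`-combination of labelled values of CERTIFIED
labelled patterns (as in `DiUnfolding.value_mem_span`) that carry, in addition, a CONSISTENT 2-COLOURING `col`
(every edge from a `false` vertex to a `true` vertex) extending the label colouring (row labels `false`, column
labels `true`).  Same induction as the one-sorted unfolding, with the colour carried along
(`colour_glue_left/right`, `colour_forget`). [folklore] -/
theorem value_mem_span_coloured (e : PatternExpr ℂ k l) :
    (fun ℓ : Fin (k + l) → Fin n => e.value n (ℓ ∘ Fin.castAdd l) (ℓ ∘ Fin.natAdd k)) ∈ Submodule.span ℂ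
      {F : (Fin (k + l) → Fin n) → MvPolynomial (Fin n × Fin n) ℂ |
        ∃ (m : ℕ) (E : Multiset ((Fin (k + l) ⊕ Fin m) × (Fin (k + l) ⊕ Fin m)))
          (N : Fin m → Finset (Fin (k + l) ⊕ Fin m)) (col : Fin (k + l) ⊕ Fin m → Bool),
          ((∀ j, (N j).card ≤ k + l - 1) ∧ (∀ j j', Sum.inr j' ∈ N j → j < j') ∧
            (∀ (j : Fin m) (b : Fin (k + l)),
              ((Sum.inr j, Sum.inl b) ∈ E ∨ (Sum.inl b, Sum.inr j) ∈ E) → Sum.inl b ∈ N j) ∧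
            (∀ j j' : Fin m,
              ((Sum.inr j, Sum.inr j') ∈ E ∨ (Sum.inr j', Sum.inr j) ∈ E) → j < j' → Sum.inr j' ∈ N j) ∧
            (∀ j j₁ j₂ : Fin m, Sum.inr j₁ ∈ N j → Sum.inr j₂ ∈ N j → j₁ < j₂ → Sum.inr j₂ ∈ N j₁) ∧
            (∀ (j j₁ : Fin m) (b : Fin (k + l)), Sum.inr j₁ ∈ N j → Sum.inl b ∈ N j → Sum.inl b ∈ N j₁)) ∧
          (∀ d ∈ E, col d.1 = false ∧ col d.2 = true) ∧
          (∀ c : Fin (k + l), col (Sum.inl c) = decide (k ≤ (c : ℕ))) ∧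
          F = fun ℓ => ∑ g : Fin m → Fin n, (E.map fun e =>
            (X (Sum.elim ℓ g e.1, Sum.elim ℓ g e.2) : MvPolynomial (Fin n × Fin n) ℂ)).prod} := by
  set lab : Fin (k + l) → Bool := fun c => decide (k ≤ (c : ℕ)) with hlabdef
  set S : Set ((Fin (k + l) → Fin n) → MvPolynomial (Fin n × Fin n) ℂ) :=
    {F : (Fin (k + l) → Fin n) → MvPolynomial (Fin n × Fin n) ℂ |
        ∃ (m : ℕ) (E : Multiset ((Fin (k + l) ⊕ Fin m) × (Fin (k + l) ⊕ Fin m)))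
          (N : Fin m → Finset (Fin (k + l) ⊕ Fin m)) (col : Fin (k + l) ⊕ Fin m → Bool),
          ((∀ j, (N j).card ≤ k + l - 1) ∧ (∀ j j', Sum.inr j' ∈ N j → j < j') ∧
            (∀ (j : Fin m) (b : Fin (k + l)),
              ((Sum.inr j, Sum.inl b) ∈ E ∨ (Sum.inl b, Sum.inr j) ∈ E) → Sum.inl b ∈ N j) ∧
            (∀ j j' : Fin m,
              ((Sum.inr j, Sum.inr j') ∈ E ∨ (Sum.inr j', Sum.inr j) ∈ E) → j < j' → Sum.inr j' ∈ N j) ∧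
            (∀ j j₁ j₂ : Fin m, Sum.inr j₁ ∈ N j → Sum.inr j₂ ∈ N j → j₁ < j₂ → Sum.inr j₂ ∈ N j₁) ∧
            (∀ (j j₁ : Fin m) (b : Fin (k + l)), Sum.inr j₁ ∈ N j → Sum.inl b ∈ N j → Sum.inl b ∈ N j₁)) ∧
          (∀ d ∈ E, col d.1 = false ∧ col d.2 = true) ∧
          (∀ c : Fin (k + l), col (Sum.inl c) = lab c) ∧
          F = fun ℓ => ∑ g : Fin m → Fin n, (E.map fun e =>
            (X (Sum.elim ℓ g e.1, Sum.elim ℓ g e.2) : MvPolynomial (Fin n × Fin n) ℂ)).prod} with hS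
  -- patterns without inner vertices, coloured by the label colouring, are certified for free
  have triv : ∀ E : Multiset ((Fin (k + l) ⊕ Fin 0) × (Fin (k + l) ⊕ Fin 0)),
      (∀ d ∈ E, Sum.elim lab Fin.elim0 d.1 = false ∧ Sum.elim lab Fin.elim0 d.2 = true) →
      (fun ℓ : Fin (k + l) → Fin n => ∑ g : Fin 0 → Fin n, (E.map fun e =>
        (X (Sum.elim ℓ g e.1, Sum.elim ℓ g e.2) : MvPolynomial (Fin n × Fin n) ℂ)).prod) ∈ S :=
    fun E hE => ⟨0, E, fun j => j.elim0, Sum.elim lab Fin.elim0,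
      ⟨fun j => j.elim0, fun j => j.elim0, fun j => j.elim0, fun j => j.elim0, fun j => j.elim0, fun j => j.elim0⟩,
      hE, fun c => rfl, rfl⟩
  have hlabrow : ∀ a : Fin k, lab (Fin.castAdd l a) = false := fun a => by
    simp [hlabdef]
  have hlabcol : ∀ b : Fin l, lab (Fin.natAdd k b) = true := fun b => by
    simp [hlabdef]
  induction e with
  | edge a b =>
    refine Submodule.subset_span ((congrArg (· ∈ S) ?_).mpr
      (triv {(Sum.inl (Fin.castAdd l a), Sum.inl (Fin.natAdd k b))} ?_))
    · funext ℓ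
      simp
    · intro d hd
      rw [Multiset.mem_singleton] at hd
      subst hd
      exact ⟨hlabrow a, hlabcol b⟩
  | const c =>
    have h : (fun ℓ : Fin (k + l) → Fin n =>
        (PatternExpr.const c : PatternExpr ℂ k l).value n (ℓ ∘ Fin.castAdd l) (ℓ ∘ Fin.natAdd k)) =
        c • fun ℓ : Fin (k + l) → Fin n => ∑ g : Fin 0 → Fin n,
          ((0 : Multiset ((Fin (k + l) ⊕ Fin 0) × (Fin (k + l) ⊕ Fin 0))).map fun e =>
            (X (Sum.elim ℓ g e.1, Sum.elim ℓ g e.2) : MvPolynomial (Fin n × Fin n) ℂ)).prod := by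
      funext ℓ
      simp [MvPolynomial.C_eq_smul_one]
    rw [h]
    exact Submodule.smul_mem _ c (Submodule.subset_span (triv 0 (fun d hd => by simp at hd)))
  | add e₁ e₂ ih₁ ih₂ =>
    have h : (fun ℓ : Fin (k + l) → Fin n => (e₁.add e₂).value n (ℓ ∘ Fin.castAdd l) (ℓ ∘ Fin.natAdd k)) =
        (fun ℓ => e₁.value n (ℓ ∘ Fin.castAdd l) (ℓ ∘ Fin.natAdd k)) +
          fun ℓ => e₂.value n (ℓ ∘ Fin.castAdd l) (ℓ ∘ Fin.natAdd k) := by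
      funext ℓ
      rfl
    rw [h]
    exact Submodule.add_mem _ ih₁ ih₂
  | mul e₁ e₂ ih₁ ih₂ =>
    have hmul : ∀ F ∈ S, ∀ G ∈ S, F * G ∈ S := by
      rintro _ ⟨m₁, E₁, N₁, col₁, ⟨a1, a2, a3, a4, a5, a6⟩, hc₁, hl₁, rfl⟩
        _ ⟨m₂, E₂, N₂, col₂, ⟨b1, b2, b3, b4, b5, b6⟩, hc₂, hl₂, rfl⟩
      refine ⟨m₁ + m₂, _, _, Sum.elim lab (Fin.append (fun j => col₁ (Sum.inr j)) (fun j => col₂ (Sum.inr j))),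
        certificate_glue E₁ N₁ E₂ N₂ a1 a2 a3 a4 a5 a6 b1 b2 b3 b4 b5 b6 _ rfl _ rfl, ?_, fun c => rfl, ?_⟩
      · intro d hd
        rcases Multiset.mem_add.1 hd with hd | hd
        · obtain ⟨d', hd', rfl⟩ := Multiset.mem_map.1 hd
          simp only [Prod.map_fst, Prod.map_snd, colour_glue_left lab col₁ col₂ hl₁]
          exact hc₁ d' hd'
        · obtain ⟨d', hd', rfl⟩ := Multiset.mem_map.1 hd
          simp only [Prod.map_fst, Prod.map_snd, colour_glue_right lab col₁ col₂ hl₂]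
          exact hc₂ d' hd'
      · funext ℓ
        exact labelledValue_glue n E₁ E₂ ℓ
    have h : (fun ℓ : Fin (k + l) → Fin n => (e₁.mul e₂).value n (ℓ ∘ Fin.castAdd l) (ℓ ∘ Fin.natAdd k)) =
        (fun ℓ => e₁.value n (ℓ ∘ Fin.castAdd l) (ℓ ∘ Fin.natAdd k)) *
          fun ℓ => e₂.value n (ℓ ∘ Fin.castAdd l) (ℓ ∘ Fin.natAdd k) := by
      funext ℓ
      rfl
    rw [h]
    have hle : Submodule.span ℂ S * Submodule.span ℂ S ≤ Submodule.span ℂ S := by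
      rw [Submodule.span_mul_span]
      refine Submodule.span_le.2 ?_
      rintro _ ⟨F, hF, G, hG, rfl⟩
      exact Submodule.subset_span (hmul F hF G hG)
    exact hle (Submodule.mul_mem_mul ih₁ ih₂)
  | sumRow a e ih =>
    let T : ((Fin (k + l) → Fin n) → MvPolynomial (Fin n × Fin n) ℂ) →ₗ[ℂ]
        ((Fin (k + l) → Fin n) → MvPolynomial (Fin n × Fin n) ℂ) :=
      ∑ v : Fin n, LinearMap.funLeft ℂ (MvPolynomial (Fin n × Fin n) ℂ)
        (fun ℓ : Fin (k + l) → Fin n => Function.update ℓ (Fin.castAdd l a) v)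
    have hT : ∀ F ℓ, T F ℓ = ∑ v, F (Function.update ℓ (Fin.castAdd l a) v) := by
      intro F ℓ
      simp only [T, LinearMap.coe_sum, Finset.sum_apply, LinearMap.funLeft_apply]
    have hmap : ∀ F ∈ S, T F ∈ S := by
      rintro _ ⟨m, E, N, col, ⟨a1, a2, a3, a4, a5, a6⟩, hc, hl, rfl⟩
      refine ⟨m + 1, _, _, Sum.elim lab (Fin.append (fun j => col (Sum.inr j))
          (fun _ : Fin 1 => col (Sum.inl (Fin.castAdd l a)))),
        certificate_forget (Fin.castAdd l a) E N a1 a2 a3 a4 a5 a6 _ rfl _ rfl, ?_, fun c => rfl, ?_⟩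
      · intro d hd
        obtain ⟨d', hd', rfl⟩ := Multiset.mem_map.1 hd
        simp only [Prod.map_fst, Prod.map_snd, colour_forget (Fin.castAdd l a) lab col hl]
        exact hc d' hd'
      · funext ℓ
        rw [hT]
        exact labelledValue_forget n (Fin.castAdd l a) E ℓ
    have h : (fun ℓ : Fin (k + l) → Fin n => (e.sumRow a).value n (ℓ ∘ Fin.castAdd l) (ℓ ∘ Fin.natAdd k)) =
        T fun ℓ => e.value n (ℓ ∘ Fin.castAdd l) (ℓ ∘ Fin.natAdd k) := by
      funext ℓ
      rw [hT, PatternExpr.value_sumRow]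
      refine Finset.sum_congr rfl fun v _ => ?_
      rw [Function.update_comp_eq_of_injective _ (Fin.castAdd_injective k l),
        Function.update_comp_eq_of_forall_ne _ _ fun b => (CompressionFloors.castAdd_ne_natAdd a b).symm]
    rw [h]
    have hle : Submodule.map T (Submodule.span ℂ S) ≤ Submodule.span ℂ S :=
      (Submodule.map_span_le _ _ _).2 fun F hF => Submodule.subset_span (hmap F hF)
    exact hle (Submodule.mem_map_of_mem ih)
  | sumCol b e ih =>
    let T : ((Fin (k + l) → Fin n) → MvPolynomial (Fin n × Fin n) ℂ) →ₗ[ℂ]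
        ((Fin (k + l) → Fin n) → MvPolynomial (Fin n × Fin n) ℂ) :=
      ∑ v : Fin n, LinearMap.funLeft ℂ (MvPolynomial (Fin n × Fin n) ℂ)
        (fun ℓ : Fin (k + l) → Fin n => Function.update ℓ (Fin.natAdd k b) v)
    have hT : ∀ F ℓ, T F ℓ = ∑ v, F (Function.update ℓ (Fin.natAdd k b) v) := by
      intro F ℓ
      simp only [T, LinearMap.coe_sum, Finset.sum_apply, LinearMap.funLeft_apply]
    have hmap : ∀ F ∈ S, T F ∈ S := by
      rintro _ ⟨m, E, N, col, ⟨a1, a2, a3, a4, a5, a6⟩, hc, hl, rfl⟩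
      refine ⟨m + 1, _, _, Sum.elim lab (Fin.append (fun j => col (Sum.inr j))
          (fun _ : Fin 1 => col (Sum.inl (Fin.natAdd k b)))),
        certificate_forget (Fin.natAdd k b) E N a1 a2 a3 a4 a5 a6 _ rfl _ rfl, ?_, fun c => rfl, ?_⟩
      · intro d hd
        obtain ⟨d', hd', rfl⟩ := Multiset.mem_map.1 hd
        simp only [Prod.map_fst, Prod.map_snd, colour_forget (Fin.natAdd k b) lab col hl]
        exact hc d' hd'
      · funext ℓ
        rw [hT]
        exact labelledValue_forget n (Fin.natAdd k b) E ℓ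
    have h : (fun ℓ : Fin (k + l) → Fin n => (e.sumCol b).value n (ℓ ∘ Fin.castAdd l) (ℓ ∘ Fin.natAdd k)) =
        T fun ℓ => e.value n (ℓ ∘ Fin.castAdd l) (ℓ ∘ Fin.natAdd k) := by
      funext ℓ
      rw [hT, PatternExpr.value_sumCol]
      refine Finset.sum_congr rfl fun v _ => ?_
      rw [Function.update_comp_eq_of_injective _ (Fin.natAdd_injective l k),
        Function.update_comp_eq_of_forall_ne _ _ fun a => CompressionFloors.castAdd_ne_natAdd a b]
    rw [h]
    have hle : Submodule.map T (Submodule.span ℂ S) ≤ Submodule.span ℂ S :=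
      (Submodule.map_span_le _ _ _).2 fun F hF => Submodule.subset_span (hmap F hF)
    exact hle (Submodule.mem_map_of_mem ih)


/-! ### The closed polynomial: K1ᵉ ⟹ K1 -/

/-- The closed polynomial of a bipartite expression is the sum of its one-sorted-read labelled values over all
assignments `ℓ : Fin (k + l) → Fin n`. [folklore] -/
theorem close_eq_sum_value (e : PatternExpr ℂ k l) :
    e.close n = ∑ ℓ : Fin (k + l) → Fin n, e.value n (ℓ ∘ Fin.castAdd l) (ℓ ∘ Fin.natAdd k) := by
  rw [PatternExpr.close, ← Fintype.sum_prod_type']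
  refine Fintype.sum_equiv (Fin.appendEquiv k l) _ _ fun p => ?_
  have h1 : (Fin.appendEquiv k l p) ∘ Fin.castAdd l = p.1 := by
    funext i; simp [Fin.appendEquiv, Fin.append_left]
  have h2 : (Fin.appendEquiv k l p) ∘ Fin.natAdd k = p.2 := by
    funext i; simp [Fin.appendEquiv, Fin.append_right]
  rw [h1, h2]

/-- **BIPARTITE UNFOLDING (K1ᵉ ⟹ K1), EVERY LEVEL, EVERY DEGREE.**  The closed polynomial of a labelled BIPARTITE
pattern expression over `ℂ` with `k` row and `l` column labels, of any length, lies in the `ℂ`-span of the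
homomorphism polynomials of BIPARTITE patterns of treewidth `≤ k + l - 1`.  (Close the coloured unfolding
`value_mem_span_coloured`: `Σ_ℓ` of a labelled value is `dihom` of the certified pattern
(`DiUnfolding.labelledValue_close`), of treewidth `≤ k + l - 1` (`DiUnfolding.treewidth_le_of_certificate`), and a
consistently 2-coloured one-sorted pattern is a bipartite pattern of no larger treewidth
(`BlockDescent.exists_homPoly_eq_diHomPoly_of_colouring`).)  This is the expression → span converse of K2
`HomPolyClose` for the bipartite graph algebra — census item "K1ᵉ ⟹ K1" of the line-`birth` hands, in full.
[folklore] -/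
theorem close_mem_span_homPoly (k l n : ℕ) (e : PatternExpr ℂ k l) :
    e.close n ∈ Submodule.span ℂ {q : MvPolynomial (Fin n × Fin n) ℂ |
      ∃ (a b : ℕ) (F : Multiset (Fin a × Fin b)),
        treewidth (SimpleGraph.fromRel fun u v : Fin a ⊕ Fin b =>
            ∃ e ∈ F, u = Sum.inl e.1 ∧ v = Sum.inr e.2) ≤ k + l - 1 ∧
          q = homPoly F n ℂ} := by
  let Φ : ((Fin (k + l) → Fin n) → MvPolynomial (Fin n × Fin n) ℂ) →ₗ[ℂ] MvPolynomial (Fin n × Fin n) ℂ :=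
    ∑ ℓ : Fin (k + l) → Fin n, LinearMap.proj ℓ
  have hΦ : ∀ F, Φ F = ∑ ℓ, F ℓ := by
    intro F
    simp only [Φ, LinearMap.coe_sum, Finset.sum_apply, LinearMap.proj_apply]
  have hclose : e.close n = Φ fun ℓ => e.value n (ℓ ∘ Fin.castAdd l) (ℓ ∘ Fin.natAdd k) := by
    rw [hΦ, close_eq_sum_value]
  rw [hclose]
  refine ((Submodule.map_span_le _ _ _).2 ?_) (Submodule.mem_map_of_mem (value_mem_span_coloured n e))
  rintro _ ⟨m, E, N, col, ⟨a1, a2, a3, a4, a5, a6⟩, hcol, -, rfl⟩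
  obtain ⟨a', b', F, hF, hFhom, -, -⟩ := BlockDescent.exists_homPoly_eq_diHomPoly_of_colouring E col hcol n
  refine Submodule.subset_span ⟨a', b', F, hF.trans (treewidth_le_of_certificate E N a1 a2 a3 a4 a5 a6), ?_⟩
  rw [hΦ, hFhom]
  exact labelledValue_close n E

/-- **Width form**: for `k + l ≤ w + 1`, the closed polynomial of a bipartite `k,l`-label expression lies in the
bipartite narrow span of width `w`. [folklore] -/
theorem close_mem_narrowSpan (k l n w : ℕ) (hw : k + l ≤ w + 1) (e : PatternExpr ℂ k l) :
    e.close n ∈ Submodule.span ℂ {q : MvPolynomial (Fin n × Fin n) ℂ |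
      ∃ (a b : ℕ) (F : Multiset (Fin a × Fin b)),
        treewidth (SimpleGraph.fromRel fun u v : Fin a ⊕ Fin b =>
            ∃ e ∈ F, u = Sum.inl e.1 ∧ v = Sum.inr e.2) ≤ w ∧
          q = homPoly F n ℂ} := by
  refine Submodule.span_mono (fun q hq => ?_) (close_mem_span_homPoly k l n e)
  obtain ⟨a, b, F, hF, rfl⟩ := hq
  exact ⟨a, b, F, hF.trans (by omega), rfl⟩

end Summit.ValiantsHypothesis.ValiantsHypothesis.Theorems.BipartiteUnfoldingColoured

end
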